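import Summits.QuantumFields.BalabanUV.T4Continuum.Support.ShellMeasureWilsonGradientTail
import Summits.QuantumFields.BalabanUV.T4Continuum.Support.ShellMeasureCubicTaylor

/-!
# `T4Continuum.ShellMeasurePlaquetteTwist` — TWISTING the one-grid plaquette word: `U_A(∂p) = e^{y₁}e^{y₂}e^{y₃}e^{y₄}·U₀(∂p)`
# with conjugated bond variables `yᵢ`, its inverse `U₀(∂p)⁻¹·e^{−y₄}⋯e^{−y₁}`, and the SYMMETRISED plaquette functional
# (file 3 of 5 of «S65 f4»: [Balaban1985Variational] (34) BCH-free, on the owner's S62 f2 objects)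

Cell `pub-balaban`, sub-cell `t4`, spine estimate NE7c (node U5b), NE7c ROUND-2 crew `t4-ne7c-formalise-*`, unit
`b2b-balaban-t4-ne7c-formalise-leaf-03` gen 4; owner table `t4/b2b-balaban-t4-ne7c-p1/LEAVES-NE7c-P1.md` v2.9 row **S65 f4**
(owner GO journal l.15517, row holder leaf-02-g8 GO l.15529).  ADDITIVE: imports the owner's S62 f2
`ShellMeasureWilsonGradientTail` (`letter`, `plaqWord`, `plaqFun`, `expWord_plaqWord`) and file 1 `ShellMeasureCubicTaylor`
(`expProd`); modifies nothing; [folklore]; 0 `def … : Prop`, 0 sorry, 0 citation tags.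

HONEST FRAMING.  Finite four-torus programme, rung (B)+1 only — NOT infinite volume, NOT a mass gap, NOT the Clay
problem, NOT summit progress.  NE7c (`T4IndicatorShell.ShellWeightBound`) is NOT PRINTED and NOT PROVED; «NE7c ⇐ the
named binders».  Nothing of [Balaban1985Variational] is asserted: p. 283 (34) (the twisted variables «A′(b) for bonds
b ⊂ ∂p»), p. 284 (39) «V₀(A, ∂p) = ¼ i tr(DA)(p)·Σ_{b₁<b₂} i[A′(b₁), A′(b₂)] + V₀′(A, ∂p)» and (40), with (33) (the quartic
tail) and (38) (the hidden small factor `Re U₀(∂p) − 1`), are LOCATORS for the SHAPE reproduced at ONE GRID (`Lʲη = η`, sup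
norms, no `η`-weights — the printed currency is row S63 (a)'s and S65 f2a's bookkeeping).  HONEST DEPENDENCY (cell,
verbatim): continuum YM on T⁴ ⇐ BetaPertH ∧ nine spine estimates (0/9 proved); BetaPertH ⇐ (D1) ∧ (D4) ∧ CAP+tail; G-an2-4
gates asym, D1 and NE2/3/4.

WHAT IS PROVED (S62's currency: `𝔸` complete normed ℂ-algebra, `U : Λ → 𝔸ˣ`, oriented letters `Λ × Bool`):
* §1 `wordU U A l` (the word of a list of letters; `plaqWord U bd A = wordU U A (List.ofFn bd)`), `twistVar`∕`twists` (the
  twisted variables `I • hA(b)h⁻¹` ∕ `(−I) • h′A(b)h′⁻¹` along the background prefixes), **`val_mul_wordU`**∕**`val_wordU_eq`**: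
  `U_A(word) = expProd (twists U 1 word A) · U₀(word)` (induction on the word, one conjugation `h·e^X = e^{hXh⁻¹}·h` per
  letter), **`val_inv_wordU_eq`**: `U_A(word)⁻¹ = U₀(word)⁻¹ · expProd (reversed negated twists)`; for a unit-bounded
  background every prefix is in `U1`, so `‖yᵢ‖ ≤ ‖A(bᵢ)‖` and `Σ‖yᵢ‖ ≤ Σ‖A(bᵢ)‖` (`sum_norm_twists_le`); linearity
  `twists U h l (t • A) = (twists U h l A).map (t • ·)`.
* §2 `plaqFunSym τ U bd A := ½(τ(1 − U_A(∂p)) + τ(1 − U_A(∂p)⁻¹))` — S62 f2's «Re tr realised by pairing a boundary with its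
  reverse» as ONE functional — ENTIRE in `A` (`analyticAt_plaqFunSym`, both words are `ExpWord`s).
-/

noncomputable section

open scoped BigOperators
open NormedSpace Metric Set

namespace Summit.QuantumFields.BalabanUV.T4Continuum.ShellMeasurePlaquetteTwist

open Literature.MathematicalPhysics.QuantumFieldTheory.Balaban1983to89
open B7Prop1Explicit (U1 mem_U1)
open B7Eq78Linearization (conjR conjR_apply conjR_smul)
open B8Ineq132 (norm_conjR_le)
open B8Eq146AExpansion (exp_conjR)
open B12AverageCorridor267 (expU val_expU val_inv_expU expU_zero)
open ShellMeasureWilsonGradientTail (letter plaqWord plaqFun expWord_plaqWord analyticAt_plaqFun)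
open ShellMeasureCubicTaylor (expProd expProd_nil expProd_cons)

variable {Λ : Type*} {𝔸 : Type*} [NormedRing 𝔸] [NormedAlgebra ℂ 𝔸] [CompleteSpace 𝔸]

/-! ## §1 Twisting: the word of the perturbed configuration as a product of exponentials times the background word -/

/-- The word of a list of oriented letters (S62 f2's `plaqWord` is the case `List.ofFn bd`). [folklore] -/
def wordU (U : Λ → 𝔸ˣ) (A : Λ → 𝔸) (l : List (Λ × Bool)) : 𝔸ˣ := (l.map (letter U A)).prod

/-- THE TWISTED VARIABLE of an oriented letter seen through the background prefix `h`: `I • hA(b)h⁻¹` for a forward letter,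
`−I • h′A(b)h′⁻¹` with `h′ = hU(b)⁻¹` for a backward one (print's «field variables A′(b) for bonds b ⊂ ∂p», (34) p. 283).
[folklore] -/
def twistVar (U : Λ → 𝔸ˣ) (h : 𝔸ˣ) (bσ : Λ × Bool) (A : Λ → 𝔸) : 𝔸 :=
  if bσ.2 then conjR h (Complex.I • A bσ.1) else conjR (h * (U bσ.1)⁻¹) ((-Complex.I) • A bσ.1)

/-- The list of twisted variables along a word, the background prefix advancing letter by letter. [folklore] -/
def twists (U : Λ → 𝔸ˣ) : 𝔸ˣ → List (Λ × Bool) → (Λ → 𝔸) → List 𝔸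
  | _, [], _ => []
  | h, bσ :: l, A => twistVar U h bσ A :: twists U (h * letter U 0 bσ) l A

/-- [folklore] -/
@[simp] theorem twists_nil (U : Λ → 𝔸ˣ) (h : 𝔸ˣ) (A : Λ → 𝔸) : twists U h [] A = [] := rfl

/-- [folklore] -/
@[simp] theorem twists_cons (U : Λ → 𝔸ˣ) (h : 𝔸ˣ) (bσ : Λ × Bool) (l : List (Λ × Bool)) (A : Λ → 𝔸) :
    twists U h (bσ :: l) A = twistVar U h bσ A :: twists U (h * letter U 0 bσ) l A := rfl

/-- [folklore] -/
@[simp] theorem wordU_nil (U : Λ → 𝔸ˣ) (A : Λ → 𝔸) : wordU U A [] = 1 := by simp [wordU]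

/-- [folklore] -/
@[simp] theorem wordU_cons (U : Λ → 𝔸ˣ) (A : Λ → 𝔸) (bσ : Λ × Bool) (l : List (Λ × Bool)) :
    wordU U A (bσ :: l) = letter U A bσ * wordU U A l := by simp [wordU]

/-- S62 f2's plaquette word is the word of `List.ofFn bd`. [folklore] -/
theorem plaqWord_eq_wordU (U : Λ → 𝔸ˣ) (bd : Fin 4 → Λ × Bool) (A : Λ → 𝔸) :
    plaqWord U bd A = wordU U A (List.ofFn bd) := rfl

/-- The background letter: `letter U 0 (b, σ) = U(b)^{±1}`. [folklore] -/
theorem letter_zero (U : Λ → 𝔸ˣ) (bσ : Λ × Bool) :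
    letter U (0 : Λ → 𝔸) bσ = if bσ.2 then U bσ.1 else (U bσ.1)⁻¹ := by
  unfold letter
  simp

/-- `e^{uXu⁻¹}·u = u·e^{X}`. [folklore] -/
theorem exp_conjR_mul (u : 𝔸ˣ) (X : 𝔸) : exp (conjR u X) * (u : 𝔸) = (u : 𝔸) * exp X := by
  rw [exp_conjR, conjR_apply, mul_assoc, Units.inv_mul, mul_one]

/-- ONE LETTER: `h · (e^{IA(b)}U(b))^{±1} = e^{y} · (h · U(b)^{±1})` with `y` the twisted variable. [folklore] -/
theorem val_mul_letter (U : Λ → 𝔸ˣ) (h : 𝔸ˣ) (bσ : Λ × Bool) (A : Λ → 𝔸) :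
    (h : 𝔸) * (letter U A bσ : 𝔸) = exp (twistVar U h bσ A) * ((h * letter U 0 bσ : 𝔸ˣ) : 𝔸) := by
  rw [letter_zero]
  rcases bσ with ⟨b, σ⟩
  cases σ
  · -- backward letter: `h U⁻¹ e^{−IA} = e^{(hU⁻¹)(−IA)(hU⁻¹)⁻¹} (h U⁻¹)`
    simp only [letter, twistVar, Bool.false_eq_true, if_false, mul_inv_rev, Units.val_mul, val_inv_expU]
    rw [neg_smul, ← Units.val_mul, exp_conjR_mul, Units.val_mul, mul_assoc]
  · -- forward letter: `h e^{IA} U = e^{h(IA)h⁻¹} h U`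
    simp only [letter, twistVar, if_true, Units.val_mul, val_expU]
    rw [← mul_assoc, ← mul_assoc, exp_conjR_mul]

/-- **TWISTING** ([Balaban1985Variational] (34), BCH-free): `h · U_A(word) = e^{y₁}⋯e^{yₙ} · (h · U₀(word))`.
[folklore] -/
theorem val_mul_wordU (U : Λ → 𝔸ˣ) (A : Λ → 𝔸) :
    ∀ (l : List (Λ × Bool)) (h : 𝔸ˣ),
      (h : 𝔸) * (wordU U A l : 𝔸) = expProd (twists U h l A) * ((h * wordU U 0 l : 𝔸ˣ) : 𝔸)
  | [], h => by simp [expProd_nil]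
  | bσ :: l, h => by
    rw [wordU_cons, wordU_cons, twists_cons, expProd_cons, Units.val_mul, ← mul_assoc, val_mul_letter, mul_assoc,
      val_mul_wordU U A l (h * letter U 0 bσ), ← mul_assoc, Units.val_mul, Units.val_mul, Units.val_mul, Units.val_mul]
    simp only [mul_assoc]

/-- The case `h = 1`: `U_A(word) = e^{y₁}⋯e^{yₙ} · U₀(word)`. [folklore] -/
theorem val_wordU_eq (U : Λ → 𝔸ˣ) (A : Λ → 𝔸) (l : List (Λ × Bool)) :
    (wordU U A l : 𝔸) = expProd (twists U 1 l A) * (wordU U 0 l : 𝔸) := by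
  have h := val_mul_wordU U A l 1
  rwa [Units.val_one, one_mul, one_mul] at h

omit [NormedAlgebra ℂ 𝔸] [CompleteSpace 𝔸] in
/-- `expProd` is multiplicative under concatenation. [folklore] -/
theorem expProd_append (l₁ l₂ : List 𝔸) : expProd (l₁ ++ l₂) = expProd l₁ * expProd l₂ := by
  simp [expProd, List.map_append, List.prod_append]

/-- `e^{y₁}⋯e^{yₙ} · e^{−yₙ}⋯e^{−y₁} = 1`. [folklore] -/
theorem expProd_mul_rev : ∀ ys : List 𝔸, expProd ys * expProd (ys.reverse.map Neg.neg) = 1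
  | [] => by simp
  | y :: ys => by
    have ih := expProd_mul_rev ys
    have hy : exp y * exp (-y) = 1 := by
      rw [← val_inv_expU y, ← val_expU y]
      exact Units.mul_inv _
    rw [List.reverse_cons, List.map_append, List.map_singleton, expProd_append, expProd_cons, mul_assoc,
      ← mul_assoc (expProd ys), ih, one_mul]
    simp [expProd, hy]

/-- `e^{−yₙ}⋯e^{−y₁} · e^{y₁}⋯e^{yₙ} = 1`. [folklore] -/
theorem expProd_rev_mul : ∀ ys : List 𝔸, expProd (ys.reverse.map Neg.neg) * expProd ys = 1
  | [] => by simp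
  | y :: ys => by
    have ih := expProd_rev_mul ys
    have hy : exp (-y) * exp y = 1 := by
      rw [← val_inv_expU y, ← val_expU y]
      exact Units.inv_mul _
    have h1 : expProd [-y] * expProd (y :: ys) = expProd ys := by
      have e : expProd [-y] = exp (-y) := by simp [expProd]
      rw [e, expProd_cons, ← mul_assoc, hy, one_mul]
    rw [List.reverse_cons, List.map_append, List.map_singleton, expProd_append, mul_assoc, h1, ih]

/-- THE INVERSE WORD: `U_A(word)⁻¹ = U₀(word)⁻¹ · e^{−yₙ}⋯e^{−y₁}`. [folklore] -/
theorem val_inv_wordU_eq (U : Λ → 𝔸ˣ) (A : Λ → 𝔸) (l : List (Λ × Bool)) :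
    (((wordU U A l)⁻¹ : 𝔸ˣ) : 𝔸) =
      (((wordU U 0 l)⁻¹ : 𝔸ˣ) : 𝔸) * expProd ((twists U 1 l A).reverse.map Neg.neg) := by
  apply Units.inv_eq_of_mul_eq_one_right
  rw [val_wordU_eq, mul_assoc, ← mul_assoc ((wordU U 0 l : 𝔸ˣ) : 𝔸), Units.mul_inv, one_mul, expProd_mul_rev]

section Bounds

variable [NormOneClass 𝔸]

/-- Unit-bounded background letters are in `U1`. [folklore] -/
theorem letter_zero_mem_U1 {U : Λ → 𝔸ˣ} (hU : ∀ b, ‖(U b : 𝔸)‖ ≤ 1) (hU' : ∀ b, ‖(((U b)⁻¹ : 𝔸ˣ) : 𝔸)‖ ≤ 1)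
    (bσ : Λ × Bool) : letter U (0 : Λ → 𝔸) bσ ∈ U1 𝔸 := by
  rw [letter_zero]
  split_ifs
  · exact mem_U1.2 ⟨hU _, hU' _⟩
  · exact mem_U1.2 ⟨by simpa using hU' bσ.1, by simpa using hU bσ.1⟩

omit [CompleteSpace 𝔸] in
/-- `‖y‖ ≤ ‖A(b)‖` for a prefix in `U1`. [folklore] -/
theorem norm_twistVar_le {U : Λ → 𝔸ˣ} (hU : ∀ b, ‖(U b : 𝔸)‖ ≤ 1) (hU' : ∀ b, ‖(((U b)⁻¹ : 𝔸ˣ) : 𝔸)‖ ≤ 1)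
    {h : 𝔸ˣ} (hh : h ∈ U1 𝔸) (bσ : Λ × Bool) (A : Λ → 𝔸) : ‖twistVar U h bσ A‖ ≤ ‖A bσ.1‖ := by
  have hI : ‖Complex.I • A bσ.1‖ = ‖A bσ.1‖ := by rw [norm_smul, Complex.norm_I, one_mul]
  have hI' : ‖(-Complex.I) • A bσ.1‖ = ‖A bσ.1‖ := by rw [norm_smul, norm_neg, Complex.norm_I, one_mul]
  unfold twistVar
  split_ifs
  · exact (norm_conjR_le hh _).trans hI.le
  · have hh' : h * (U bσ.1)⁻¹ ∈ U1 𝔸 :=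
      (U1 𝔸).mul_mem hh ((U1 𝔸).inv_mem (mem_U1.2 ⟨hU _, hU' _⟩))
    exact (norm_conjR_le hh' _).trans hI'.le

/-- THE AMPLITUDE: `Σ‖yᵢ‖ ≤ Σ‖A(bᵢ)‖` along the word. [folklore] -/
theorem sum_norm_twists_le {U : Λ → 𝔸ˣ} (hU : ∀ b, ‖(U b : 𝔸)‖ ≤ 1) (hU' : ∀ b, ‖(((U b)⁻¹ : 𝔸ˣ) : 𝔸)‖ ≤ 1)
    (A : Λ → 𝔸) : ∀ (l : List (Λ × Bool)) {h : 𝔸ˣ}, h ∈ U1 𝔸 →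
      ((twists U h l A).map (‖·‖)).sum ≤ (l.map fun bσ => ‖A bσ.1‖).sum
  | [], _, _ => by simp
  | bσ :: l, h, hh => by
    simp only [twists_cons, List.map_cons, List.sum_cons]
    exact add_le_add (norm_twistVar_le hU hU' hh bσ A)
      (sum_norm_twists_le hU hU' A l ((U1 𝔸).mul_mem hh (letter_zero_mem_U1 hU hU' bσ)))

end Bounds

omit [CompleteSpace 𝔸] in
/-- Linearity of the twisted variables in the field. [folklore] -/
theorem twistVar_smul (U : Λ → 𝔸ˣ) (h : 𝔸ˣ) (bσ : Λ × Bool) (t : ℂ) (A : Λ → 𝔸) :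
    twistVar U h bσ (t • A) = t • twistVar U h bσ A := by
  unfold twistVar
  split_ifs <;> simp only [Pi.smul_apply, smul_comm _ t, conjR_smul]

/-- … along the word. [folklore] -/
theorem twists_smul (U : Λ → 𝔸ˣ) (t : ℂ) (A : Λ → 𝔸) :
    ∀ (l : List (Λ × Bool)) (h : 𝔸ˣ), twists U h l (t • A) = (twists U h l A).map (t • ·)
  | [], h => by simp
  | bσ :: l, h => by rw [twists_cons, twists_cons, List.map_cons, twistVar_smul, twists_smul U t A l]

omit [CompleteSpace 𝔸] in
/-- Negating and reversing commute with scaling. [folklore] -/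
theorem reverse_map_neg_smul (t : ℂ) (ys : List 𝔸) :
    ((ys.map (t • ·)).reverse.map Neg.neg) = (ys.reverse.map Neg.neg).map (t • ·) := by
  simp [List.map_reverse, List.map_map, Function.comp_def, smul_neg]

omit [NormedAlgebra ℂ 𝔸] [CompleteSpace 𝔸] in
/-- The reversed negated word has the same amplitude. [folklore] -/
theorem sum_norm_reverse_neg (ys : List 𝔸) : ((ys.reverse.map Neg.neg).map (‖·‖)).sum = (ys.map (‖·‖)).sum := by
  simp [List.map_reverse, List.map_map, Function.comp_def, norm_neg, List.sum_reverse]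

/-! ## §2 The symmetrised plaquette functional -/

/-- THE SYMMETRISED PLAQUETTE FUNCTIONAL `½(τ(1 − U_A(∂p)) + τ(1 − U_A(∂p)⁻¹))` — S62 f2's «Re tr realised by pairing a
boundary with its reverse» as ONE functional (print's `1 − Re tr U(∂p)` at real `A`, unitary `U₀`, `τ = tr`, continued to
complex `A`). [folklore] -/
def plaqFunSym (τ : 𝔸 →L[ℂ] ℂ) (U : Λ → 𝔸ˣ) (bd : Fin 4 → Λ × Bool) (A : Λ → 𝔸) : ℂ :=
  (2 : ℂ)⁻¹ * (τ (1 - (plaqWord U bd A : 𝔸)) + τ (1 - (((plaqWord U bd A)⁻¹ : 𝔸ˣ) : 𝔸)))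

/-- It is the mean of S62 f2's `plaqFun` and the inverse-word functional. [folklore] -/
theorem plaqFunSym_eq (τ : 𝔸 →L[ℂ] ℂ) (U : Λ → 𝔸ˣ) (bd : Fin 4 → Λ × Bool) (A : Λ → 𝔸) :
    plaqFunSym τ U bd A = (2 : ℂ)⁻¹ * (plaqFun τ U bd A + τ (1 - (((plaqWord U bd A)⁻¹ : 𝔸ˣ) : 𝔸))) := rfl

section Analytic

variable [Fintype Λ] [NormOneClass 𝔸] {U : Λ → 𝔸ˣ} (hU : ∀ b, ‖(U b : 𝔸)‖ ≤ 1)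
  (hU' : ∀ b, ‖(((U b)⁻¹ : 𝔸ˣ) : 𝔸)‖ ≤ 1)
include hU hU'

/-- The symmetrised functional is ENTIRE (both words are `ExpWord`s of S62 f2). [folklore] -/
theorem analyticAt_plaqFunSym (τ : 𝔸 →L[ℂ] ℂ) (bd : Fin 4 → Λ × Bool) (A : Λ → 𝔸) :
    AnalyticAt ℂ (plaqFunSym τ U bd) A := by
  have h1 := analyticAt_plaqFun hU hU' τ bd A
  have h2 : AnalyticAt ℂ (fun A => τ (1 - (((plaqWord U bd A)⁻¹ : 𝔸ˣ) : 𝔸))) A :=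
    (τ.analyticAt _).comp (analyticAt_const.sub ((expWord_plaqWord hU hU' bd).an_inv A))
  exact analyticAt_const.mul (h1.add h2)

/-- … hence analytic on every ball. [folklore] -/
theorem analyticOnNhd_plaqFunSym (τ : 𝔸 →L[ℂ] ℂ) (bd : Fin 4 → Λ × Bool) (R : ℝ) :
    AnalyticOnNhd ℂ (plaqFunSym τ U bd) (ball 0 R) := fun A _ => analyticAt_plaqFunSym hU hU' τ bd A

end Analytic


end Summit.QuantumFields.BalabanUV.T4Continuum.ShellMeasurePlaquetteTwist

end
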